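import Summits.QuantumFields.YangMills.Theorems.FradkinShenkerFlowFiniteSusceptibilityWeakCouplingOddSector
import HarnessLib

/-!
# Lattice Vafa–Witten, quantitative: β-uniform algebraic decay in the reflection-odd sector (item stmt-QuantumFields-9442)

Support file for item stmt-QuantumFields-9442 (route `FradkinShenkerFlow` of `YangMills`), crux
`Summit.QuantumFields.YangMills.Theses.FradkinShenkerFlow.FiniteSusceptibilityWeakCoupling`, line `purity-rate-split`.
The landed `…OddSector.lean` proves that a reflection-odd species `A ∘ Θ = −A` has no mirror long-range order at any `β ≥ 0`
(`stub_oddSpeciesNoMirrorLRO`, an `ε / j₀` statement). This file makes it QUANTITATIVE and UNIFORM IN THE COUPLING: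

* `OddSectorRate.mirrorCorr_le_div` — the monotone tail bound of `…MirrorMonotone` with explicit constants: if the axial `ℓ¹`
  norms of the mirror correlator `D_A` and of the swapped correlator are `≤ χ₁, χ₂` on every odd torus, then
  `0 ≤ D_A^{(S)}(j) ≤ (χ₁ + χ₂)/(j − 2R)` for `2R+1 ≤ j ≤ S` (`R` = time extent of `supp A` plus three; RP only);
* `OddSectorRate.oddSpecies_sum_abs_autocorr_le_uniform` — for odd `A` the axial `ℓ¹` norm `Σ_{n<2S+1} |Cov_{β,S}(A, τ_{n e₀} A)|`
  is bounded by `C_A = 2(4R+1)·4a²` (`a` a bound of `|A|`) for ALL `β ≥ 0` and all `S`;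
* `oddSpecies_autocorr_rate` / registered `stub_oddSpeciesMirrorRate` — **for every compact `G`, every lattice representation,
  every `β ≥ 0`, every odd torus `2S+1` and every reflection-odd gauge-invariant local `A`:
  `0 ≤ −Cov_{β,S}(A∘lift, A∘τ_{j e₀}∘lift) ≤ 2C_A/(j − 2R)` for `2R < j ≤ S`** — a coupling-independent power-law bound on the
  (non-positive) axial autocorrelation of every reflection-odd order parameter, in particular no long-range order in that
  sector anywhere in `β ∈ [0, ∞)`, uniformly.

Reflection positivity, translation invariance and boundedness only; no simplicity, no expansion. Nothing here is a named fact.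
[folklore]
-/

noncomputable section

open MeasureTheory ProbabilityTheory Finset
open Literature.MathematicalPhysics.QuantumFieldTheory hiding Site ZdEdge
open Literature.MathematicalPhysics.QuantumLattice
open Literature.Probability.LatticeModels hiding configShift configShift_apply

namespace Summit.QuantumFields.YangMills.Theorems.FiniteSusceptibilityWeakCoupling

namespace OddSectorRate

open MirrorDominationAxis0 MirrorLogConvex MirrorMonotone OddSector

variable {G : Type} [Group G] [TopologicalSpace G] [IsTopologicalGroup G] [CompactSpace G]
  [MeasurableSpace G] [BorelSpace G]

/-! ## §1 The monotone tail bound with explicit constants -/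

/-- **Quantitative monotone tail bound** (every compact `G`, `β ≥ 0`): with `R` exceeding the time coordinates of `supp A` by
three, if `Σ_{i ≤ S} |D_A^{(S)}(i)| ≤ χ₁` and `Σ_{i ≤ S} |⟨Aᴿ · τ_i A⟩ − ⟨Aᴿ⟩⟨A⟩| ≤ χ₂` on every odd torus, then for
`2R+1 ≤ j ≤ S`, `0 ≤ D_A^{(S)}(j) ≤ (χ₁ + χ₂)/(j − 2R)`. Proof as in `MirrorMonotone.mirrorDecorrelation_of_fsClause`: the
symmetrised mirror function `E = D_A + swapped` is non-negative, step-one log-convex and symmetric about `L/2`, hence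
non-increasing on `[2R+1, S]`, so `(j − 2R) E(j) ≤ Σ_{2R+1 ≤ i ≤ j} E(i) ≤ χ₁ + χ₂`, and `D_A ≤ E`. [folklore] -/
theorem mirrorCorr_le_div (r : LatticeRep G) {β : ℝ} (hβ : 0 ≤ β) (A : YMSpecies G) {R : ℕ}
    (hRA3 : ∀ e ∈ A.supp, (e.1 0).natAbs + 3 ≤ R) {χ₁ χ₂ : ℝ}
    (hax₁ : ∀ S : ℕ, ∑ i ∈ range (S + 1),
      |latticeConnectedCorr r.ρ β (2 * S + 1) A.F (fun V => A.F (cfgReflect V)) i| ≤ χ₁)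
    (hax₂ : ∀ S : ℕ, ∑ i ∈ range (S + 1),
      |latticeConnectedCorr r.ρ β (2 * S + 1) (fun V => A.F (cfgReflect V)) A.F i| ≤ χ₂)
    {S j : ℕ} (hj : 2 * R + 1 ≤ j) (hjS : j ≤ S) :
    0 ≤ latticeConnectedCorr r.ρ β (2 * S + 1) A.F (fun V => A.F (cfgReflect V)) j ∧
      latticeConnectedCorr r.ρ β (2 * S + 1) A.F (fun V => A.F (cfgReflect V)) j ≤ (χ₁ + χ₂) / ((j - 2 * R : ℕ) : ℝ) := by
  have hRA : ∀ e ∈ A.supp, (e.1 0).natAbs + 2 ≤ R := fun e he => by have := hRA3 e he; omega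
  have hRR : ∀ e ∈ (reflSpecies A).supp, (e.1 0).natAbs + 2 ≤ R := radius_reflSpecies A (k := 2) hRA3
  -- the symmetrised mirror function on the torus `2S+1`
  obtain ⟨E, hE⟩ : ∃ E : ℕ → ℝ, ∀ m, E m =
      latticeConnectedCorr r.ρ β (2 * S + 1) A.F (fun V => A.F (cfgReflect V)) m +
        latticeConnectedCorr r.ρ β (2 * S + 1) (fun V => A.F (cfgReflect V)) A.F m := ⟨_, fun _ => rfl⟩
  have h0C : ∀ m, 2 * R + 1 ≤ m → m + 2 * R ≤ 2 * S →
      0 ≤ latticeConnectedCorr r.ρ β (2 * S + 1) A.F (fun V => A.F (cfgReflect V)) m :=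
    fun m h1 h2 => mirrorCorr_nonneg r hβ A hRA h1 h2
  have h0C' : ∀ m, 2 * R + 1 ≤ m → m + 2 * R ≤ 2 * S →
      0 ≤ latticeConnectedCorr r.ρ β (2 * S + 1) (fun V => A.F (cfgReflect V)) A.F m := fun m h1 h2 => by
    rw [← mirrorCorr_reflSpecies]; exact mirrorCorr_nonneg r hβ (reflSpecies A) hRR h1 h2
  have hlC : ∀ m, 2 * R + 2 ≤ m → m + 2 * R + 1 ≤ 2 * S →
      latticeConnectedCorr r.ρ β (2 * S + 1) A.F (fun V => A.F (cfgReflect V)) m ^ 2 ≤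
        latticeConnectedCorr r.ρ β (2 * S + 1) A.F (fun V => A.F (cfgReflect V)) (m - 1) *
          latticeConnectedCorr r.ρ β (2 * S + 1) A.F (fun V => A.F (cfgReflect V)) (m + 1) :=
    fun m h1 h2 => mirrorCorr_sq_le r hβ A hRA h1 h2
  have hlC' : ∀ m, 2 * R + 2 ≤ m → m + 2 * R + 1 ≤ 2 * S →
      latticeConnectedCorr r.ρ β (2 * S + 1) (fun V => A.F (cfgReflect V)) A.F m ^ 2 ≤
        latticeConnectedCorr r.ρ β (2 * S + 1) (fun V => A.F (cfgReflect V)) A.F (m - 1) *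
          latticeConnectedCorr r.ρ β (2 * S + 1) (fun V => A.F (cfgReflect V)) A.F (m + 1) :=
    fun m h1 h2 => by
      rw [← mirrorCorr_reflSpecies, ← mirrorCorr_reflSpecies, ← mirrorCorr_reflSpecies]
      exact mirrorCorr_sq_le r hβ (reflSpecies A) hRR h1 h2
  have h0E : ∀ m, 2 * R + 1 ≤ m → m + (2 * R + 1) ≤ 2 * S + 1 → 0 ≤ E m := fun m h1 h2 => by
    rw [hE]; exact add_nonneg (h0C m h1 (by omega)) (h0C' m h1 (by omega))
  have hlE : ∀ m, 2 * R + 1 < m → m + (2 * R + 1) < 2 * S + 1 → E m ^ 2 ≤ E (m - 1) * E (m + 1) :=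
    fun m h1 h2 => by
      rw [hE, hE, hE]
      exact add_sq_le_of_sq_le (hlC m (by omega) (by omega)) (hlC' m (by omega) (by omega))
        (h0C (m - 1) (by omega) (by omega)) (h0C (m + 1) (by omega) (by omega))
        (h0C' (m - 1) (by omega) (by omega)) (h0C' (m + 1) (by omega) (by omega))
  have hsE : ∀ m, m ≤ 2 * S + 1 → E (2 * S + 1 - m) = E m := fun m hm => by
    rw [hE, hE, mirrorCorr_fold' r β A hm, ← mirrorCorr_fold r β A hm, add_comm]
  -- monotonicity and the tail bound
  have hstep := antitone_step_of_logConvex_symm h0E hlE hsE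
  have htail : ((j + 1 - (2 * R + 1) : ℕ) : ℝ) * E j ≤ ∑ i ∈ Ico (2 * R + 1) (j + 1), E i :=
    card_mul_le_sum_of_le fun i hi hij => le_of_antitone_step hstep hi hij hjS
  have hIco : ∑ i ∈ Ico (2 * R + 1) (j + 1), E i ≤ χ₁ + χ₂ := by
    calc ∑ i ∈ Ico (2 * R + 1) (j + 1), E i
        ≤ ∑ i ∈ Ico (2 * R + 1) (j + 1),
            (|latticeConnectedCorr r.ρ β (2 * S + 1) A.F (fun V => A.F (cfgReflect V)) i| +
              |latticeConnectedCorr r.ρ β (2 * S + 1) (fun V => A.F (cfgReflect V)) A.F i|) :=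
          sum_le_sum fun i _ => by rw [hE]; exact add_le_add (le_abs_self _) (le_abs_self _)
      _ ≤ ∑ i ∈ range (S + 1),
            (|latticeConnectedCorr r.ρ β (2 * S + 1) A.F (fun V => A.F (cfgReflect V)) i| +
              |latticeConnectedCorr r.ρ β (2 * S + 1) (fun V => A.F (cfgReflect V)) A.F i|) := by
          refine sum_le_sum_of_subset_of_nonneg (fun i hi => ?_) (fun i _ _ => by positivity)
          rw [mem_Ico] at hi
          exact mem_range.2 (by omega)
      _ ≤ χ₁ + χ₂ := by rw [sum_add_distrib]; exact add_le_add (hax₁ S) (hax₂ S)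
  have hCj : 0 ≤ latticeConnectedCorr r.ρ β (2 * S + 1) A.F (fun V => A.F (cfgReflect V)) j :=
    h0C j (by omega) (by omega)
  have hC'j : 0 ≤ latticeConnectedCorr r.ρ β (2 * S + 1) (fun V => A.F (cfgReflect V)) A.F j :=
    h0C' j (by omega) (by omega)
  refine ⟨hCj, ?_⟩
  have hjpos : (0 : ℝ) < ((j - 2 * R : ℕ) : ℝ) := by exact_mod_cast (show 0 < j - 2 * R by omega)
  have hcast : ((j + 1 - (2 * R + 1) : ℕ) : ℝ) = ((j - 2 * R : ℕ) : ℝ) := by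
    congr 1; omega
  have hEj : E j ≤ (χ₁ + χ₂) / ((j - 2 * R : ℕ) : ℝ) := by
    rw [le_div_iff₀ hjpos, mul_comm, ← hcast]
    exact htail.trans hIco
  have hDE : latticeConnectedCorr r.ρ β (2 * S + 1) A.F (fun V => A.F (cfgReflect V)) j ≤ E j := by
    rw [hE]; linarith
  exact hDE.trans hEj

/-! ## §2 The reflection-odd sector: coupling-uniform constants -/

/-- The axial autocorrelation of a species is bounded uniformly in the coupling, the volume and the lag: `|c_A| ≤ 4a²`.
[folklore] -/
theorem abs_autocorr_le_uniform (r : LatticeRep G) (A : YMSpecies G) :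
    ∃ B : ℝ, ∀ (β : ℝ) (S n : ℕ), |latticeConnectedCorr r.ρ β (2 * S + 1) A.F A.F n| ≤ B := by
  obtain ⟨a, ha⟩ := A.bounded
  refine ⟨4 * a * a, fun β S n => ?_⟩
  haveI : IsProbabilityMeasure (wilsonMeasure (d := 4) (L := 2 * S + 1) r.ρ β) :=
    isProbabilityMeasure_wilsonMeasure _ r.continuous β
  rw [← SiblingFunnel.covariance_eq_latticeConnectedCorr r β A A S n]
  exact Negative.abs_covariance_le_of_abs_le (fun U => ha _) (fun U => ha _)

/-- **Coupling-uniform axial `ℓ¹` bound in the odd sector**: for a reflection-odd species `A` and `R` exceeding the time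
coordinates of `supp A` by three, `Σ_{n<2S+1} |Cov_{β,S}(A, τ_{n e₀} A)| ≤ 2(4R+1)·B` for ALL `β ≥ 0` and all `S` (`B` from
`abs_autocorr_le_uniform`): RP sign on `[2R+1, 2S−2R]`, axial sum rule, `OddSector.sum_abs_le_of_sum_nonneg_of_nonpos`. [folklore] -/
theorem oddSpecies_sum_abs_autocorr_le_uniform (r : LatticeRep G) (A : YMSpecies G)
    (hodd : ∀ V, A.F (cfgReflect V) = -A.F V) {R : ℕ} (hRA3 : ∀ e ∈ A.supp, (e.1 0).natAbs + 3 ≤ R) :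
    ∃ C : ℝ, ∀ β : ℝ, 0 ≤ β → ∀ S : ℕ,
      ∑ n ∈ range (2 * S + 1), |latticeConnectedCorr r.ρ β (2 * S + 1) A.F A.F n| ≤ C := by
  have hRA : ∀ e ∈ A.supp, (e.1 0).natAbs + 2 ≤ R := fun e he => by have := hRA3 e he; omega
  obtain ⟨B, hB⟩ := abs_autocorr_le_uniform r A
  refine ⟨2 * (((2 * R + 1 : ℕ) : ℝ) + (2 * R : ℕ)) * B, fun β hβ S => ?_⟩
  refine sum_abs_le_of_sum_nonneg_of_nonpos (stub_axialSusceptibilityNonneg G r β A S)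
    (fun n hn hnS => ?_) (fun n => hB β S n)
  have h := mirrorCorr_nonneg r hβ A hRA (S := S) (m := n) hn (by omega)
  rw [mirrorCorr_eq_neg_autocorr r β A hodd] at h
  linarith

/-- **β-uniform algebraic decay of the axial autocorrelation of a reflection-odd species** (every compact `G`, every lattice
representation): there are `C` and `n₀` (depending on `A` only) such that for ALL `β ≥ 0`, all odd tori `2S+1` and all lags
`n₀ < j ≤ S`, `0 ≤ −Cov_{β,S}(A∘lift, A∘τ_{j e₀}∘lift) ≤ C/(j − n₀)`. (`n₀ = 2R`; the mirror correlator of an odd species is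
`−` its autocorrelation, `OddSector.mirrorCorr_eq_neg_autocorr`.) [folklore] -/
theorem oddSpecies_autocorr_rate (r : LatticeRep G) (A : YMSpecies G) (hodd : ∀ V, A.F (cfgReflect V) = -A.F V) :
    ∃ (C : ℝ) (n₀ : ℕ), ∀ β : ℝ, 0 ≤ β → ∀ S j : ℕ, n₀ < j → j ≤ S →
      0 ≤ -latticeConnectedCorr r.ρ β (2 * S + 1) A.F A.F j ∧
        -latticeConnectedCorr r.ρ β (2 * S + 1) A.F A.F j ≤ C / ((j - n₀ : ℕ) : ℝ) := by
  -- the time extent `R` of `A`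
  obtain ⟨R, hRA3⟩ : ∃ R : ℕ, ∀ e ∈ A.supp, (e.1 0).natAbs + 3 ≤ R := by
    refine ⟨(A.supp.sup fun e => (e.1 0).natAbs) + 3, fun e he => ?_⟩
    have := Finset.le_sup (f := fun e : ZdEdge 4 => (e.1 0).natAbs) he
    omega
  obtain ⟨C, hC⟩ := oddSpecies_sum_abs_autocorr_le_uniform r A hodd hRA3
  refine ⟨C + C, 2 * R, fun β hβ S j hj hjS => ?_⟩
  have hhalf : ∀ S : ℕ, ∑ i ∈ range (S + 1), |latticeConnectedCorr r.ρ β (2 * S + 1) A.F A.F i| ≤ C := fun S =>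
    (sum_le_sum_of_subset_of_nonneg (range_subset_range.2 (by omega)) (fun i _ _ => abs_nonneg _)).trans (hC β hβ S)
  have hax₁ : ∀ S : ℕ, ∑ i ∈ range (S + 1),
      |latticeConnectedCorr r.ρ β (2 * S + 1) A.F (fun V => A.F (cfgReflect V)) i| ≤ C := fun S => by
    simpa only [mirrorCorr_eq_neg_autocorr r β A hodd, abs_neg] using hhalf S
  have hax₂ : ∀ S : ℕ, ∑ i ∈ range (S + 1),
      |latticeConnectedCorr r.ρ β (2 * S + 1) (fun V => A.F (cfgReflect V)) A.F i| ≤ C := fun S => by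
    simpa only [swappedCorr_eq_neg_autocorr r β A hodd, abs_neg] using hhalf S
  have h := mirrorCorr_le_div r hβ A hRA3 hax₁ hax₂ (S := S) (j := j) (by omega) hjS
  rw [mirrorCorr_eq_neg_autocorr r β A hodd] at h
  exact h

end OddSectorRate

/-- **Registered sub-goal `stub_oddSpeciesMirrorRate`** of item stmt-QuantumFields-9442 (signature verbatim, fully qualified) —
**lattice Vafa–Witten, quantitative and uniform in the coupling**: for every compact `G`, every lattice representation and
every reflection-odd gauge-invariant local observable `A ∘ Θ = −A` there are `C, n₀` such that for ALL `β ≥ 0`, all odd tori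
`2S+1` and all `n₀ < j ≤ S`, `0 ≤ −Cov_{β,S}(A∘lift, A∘τ_{j e₀}∘lift) ≤ C/(j − n₀)`. [folklore] -/
theorem stub_oddSpeciesMirrorRate : ∀ (G : Type) [Group G] [TopologicalSpace G] [IsTopologicalGroup G] [CompactSpace G] [MeasurableSpace G] [BorelSpace G] (r : Literature.MathematicalPhysics.QuantumFieldTheory.LatticeRep G) (A : Literature.MathematicalPhysics.QuantumFieldTheory.YMSpecies G), (∀ V, A.F (Literature.MathematicalPhysics.QuantumFieldTheory.cfgReflect V) = -A.F V) → ∃ (C : ℝ) (n₀ : ℕ), ∀ β : ℝ, 0 ≤ β → ∀ S j : ℕ, n₀ < j → j ≤ S → 0 ≤ -Literature.MathematicalPhysics.QuantumFieldTheory.latticeConnectedCorr r.ρ β (2 * S + 1) A.F A.F j ∧ -Literature.MathematicalPhysics.QuantumFieldTheory.latticeConnectedCorr r.ρ β (2 * S + 1) A.F A.F j ≤ C / ((j - n₀ : ℕ) : ℝ) :=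
  fun _G _ _ _ _ _ _ r A hodd => OddSectorRate.oddSpecies_autocorr_rate r A hodd

end Summit.QuantumFields.YangMills.Theorems.FiniteSusceptibilityWeakCoupling

end
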